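import Summits.HubbardSuperconductivity.HubbardSuperconductivity.Theorems.WidthHaldaneFeshbachStep
import Summits.HubbardSuperconductivity.HubbardSuperconductivity.Theorems.WidthHaldaneEtaLowestWeight
import Summits.HubbardSuperconductivity.HubbardSuperconductivity.Theorems.WidthHaldaneColumnPairTriplet
import Summits.HubbardSuperconductivity.HubbardSuperconductivity.Theorems.WidthHaldanePairCorrAsRaisedCurrent
import Summits.HubbardSuperconductivity.HubbardSuperconductivity.Theorems.WidthHaldaneWideThinReduction

/-!
# `Lines/IdeaSketchK2.lean` — line `IdeaSketchK2` (cards `frustration-cost-duality`, `bochner-majority-split`,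
`eta-lowest-weight`) for crux `WidthHaldaneBridge` (stmt-HubbardSuperconductivity-16311; routes `WidthHaldane`
rank 2, `SeamInduction` rank 4)

Lead `prover-line-stmt-HubbardSuperconductivity-16311-a5-0`, 2026-08-17 (second line of the seat, after `Lines/Sketch.lean`
died at its core with 6/7 stubs landed). The served line was the ideation sketch
`Cruxes/WidthHaldaneBridge/IdeaSketchK2.lean` (rc 0, 0 sorries, no `stub_*`); this is the lead's REGISTERED skeleton:
every `sorry` lives in a `stub_*` theorem and `WidthHaldaneBridge_of` concludes the crux BY NAME. Statements are
DEF-FREE over `Theorems/WidthHaldaneDefs.lean` + Literature (`etaLower`, `etaRaise`, `expect`, `szSector`, …).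

## The line

Three handles and two honest cores.

* Card `frustration-cost-duality`: the pointwise floor is the right-derivative of the sector energy under the column
  pair source `X_r` (engine LANDED: `WidthHaldaneEnergyResponse.energyResponse_le`; exactness LANDED:
  `WidthHaldaneDualExact.widthHaldaneBridge_iff_dualBridge`); its provable step S2 `FeshbachStep` is LANDED by this
  lead in corrected form (`WidthHaldaneFeshbachStep.feshbachStep` / `haldaneLaw_of_windowLaw`, p157524: a LOW-ENERGY
  WINDOW law for `G` with a positive window implies the law with the same constants; the sketch's version over all
  real `δ` was false on empty sectors). What is left of the card is its core S3, `stub_windowBridge`: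
  `UniformThermo ⇒` a window law — composition A below.
* Card `bochner-majority-split`: positive-definiteness of `r ↦ G_ψ(r)` (LANDED `WidthHaldaneBochnerFloor.bochnerFloor`,
  `tubeColumnPairCorr_ge_of_majority`) turns "tube pair order `A·L²M² ≤ ‖Δψ‖²` and `k = 0` majority
  `(1+ε)/2·L·G_ψ(0) ≤ ‖Δψ‖²`" into the pointwise floor on WIDE tubes (`c·log L ≤ M`); THIN tubes (`M < c·log L`) keep
  the law verbatim. `stub_wideThinReduction` (provable, real arithmetic over the landed lemma) glues the two regimes
  into `HaldaneLaw` with amplitude `A·min(1, 2ε/(1+ε))`; the core is `stub_wideThinBridge`: `UniformThermo ⇒`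
  wide majority ∧ thin law — composition B.
* Card `eta-lowest-weight`: `0 < ẽ″` forces `η_ε ψ = 0` on every sector ground state (LANDED
  `WidthHaldaneEtaLowestWeight.etaLowestWeight`); the column pair field is the top of an exact pseudospin triplet:
  `stub_columnPairTriplet` (`[η,[η,Φ_a†]] = 2Φ_a`, `[η†,Φ_a†] = 0`; even `L`, `M`; sign checked against the tree's
  `etaLower ε = Σ_x ε_x c_{x↓}c_{x↑}`) and `stub_pairCorrAsRaisedCurrent` (`ηψ = 0 ⇒ ⟨Φ_aψ,Φ_bψ⟩ = ¼⟨ηK_aψ,ηK_bψ⟩`,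
  `K_a = [η,Φ_a†]` the staggered column current) — provable operator identities, handed to core B as hypotheses
  (they are the only Hubbard-specific structure available to floor `‖Δψ‖² = Σ_r G_ψ(r)`).

HONEST SIZE READING: both cores are `UniformThermo`-guarded and at least crux-strength (the window law is STRONGER
than the law — it floors `G` on all low-energy states, not only ground states; wide majority at `M ≍ L` contains 2D
tube pair order `‖Δψ‖² ≥ A·L²M²`; the thin law is the law on thin tubes). They are typed residuals, not reductions.

## Compositions (kernel-checked, no `sorry` outside `stub_*`)

A: `WidthHaldaneBridge_of` — core A + landed `haldaneLaw_of_windowLaw` (`-1 ≤ δ` from `0 < δ`).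
B: `WidthHaldaneBridge_of_wideThin` — core B (fed the two η-identities) + `stub_wideThinReduction`.
-/

noncomputable section

namespace Summit.HubbardSuperconductivity.HubbardSuperconductivity.Cruxes.WidthHaldaneBridge.Lines.IdeaSketchK2

set_option linter.dupNamespace false

open scoped BigOperators Classical Matrix ComplexConjugate
open Matrix Literature.MathematicalPhysics.QuantumLattice
open Summit.HubbardSuperconductivity.HubbardSuperconductivity.Theorems.WidthHaldane
open Summit.HubbardSuperconductivity.HubbardSuperconductivity.Theses.WidthHaldane (WidthHaldaneBridge)

/-! ## Stubs (the only `sorry`s of this file) -/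

/-- STUB 1 — CLOSED (landed `Theorems/WidthHaldaneColumnPairTriplet.lean`, p159294, sign `+2•Φ` confirmed). Operator identities. THE COLUMN PAIR FIELD IS THE TOP OF A PSEUDOSPIN TRIPLET: for even
`L`, `M`, the bipartite stagger `ε = (-1)^{a+b}` (written `if (a.val + b.val) % 2 = 0 then 1 else -1`) and the column
`d_{x²-y²}` pair field `Φ_a = Σ_b P_{e⁻¹(a,b)}`: `[η_ε, [η_ε, Φ_a†]] = 2Φ_a` and `[η_ε†, Φ_a†] = 0`
(`η_ε = etaLower ε = Σ_x ε_x c_{x↓}c_{x↑}`, `η_ε† = etaRaise ε`). Bond by bond: for a nearest-neighbour singlet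
`s_{xy} = c_{x↑}c_{y↓} - c_{x↓}c_{y↑}` with `ε_y = -ε_x`, `[η, s†_{xy}] = ε_x Σ_σ (c†_{yσ}c_{xσ} - c†_{xσ}c_{yσ})` and
`[η, that] = 2 s_{xy}`; creation monomials commute. (CAR algebra: `Literature/…/FermionOperators*.lean`,
`FermionOperatorsEtaSu2Proofs.lean`.) -/
theorem stub_columnPairTriplet :
    ∀ (L M : ℕ) [NeZero L] [NeZero M], Even L → Even M →
      ∀ (Λ : Type) [LinearOrder Λ] [Fintype Λ] (e : Λ ≃ ZMod L × ZMod M) (a : ZMod L),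
        etaLower (fun x => if ((e x).1.val + (e x).2.val) % 2 = 0 then (1 : ℤˣ) else -1) *
              (etaLower (fun x => if ((e x).1.val + (e x).2.val) % 2 = 0 then (1 : ℤˣ) else -1) *
                  (∑ b : ZMod M, tubeDWavePair L M Λ e (e.symm (a, b)))ᴴ -
                (∑ b : ZMod M, tubeDWavePair L M Λ e (e.symm (a, b)))ᴴ *
                  etaLower (fun x => if ((e x).1.val + (e x).2.val) % 2 = 0 then (1 : ℤˣ) else -1)) -
            (etaLower (fun x => if ((e x).1.val + (e x).2.val) % 2 = 0 then (1 : ℤˣ) else -1) *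
                  (∑ b : ZMod M, tubeDWavePair L M Λ e (e.symm (a, b)))ᴴ -
                (∑ b : ZMod M, tubeDWavePair L M Λ e (e.symm (a, b)))ᴴ *
                  etaLower (fun x => if ((e x).1.val + (e x).2.val) % 2 = 0 then (1 : ℤˣ) else -1)) *
              etaLower (fun x => if ((e x).1.val + (e x).2.val) % 2 = 0 then (1 : ℤˣ) else -1) =
          (2 : ℂ) • ∑ b : ZMod M, tubeDWavePair L M Λ e (e.symm (a, b)) ∧
        etaRaise (fun x => if ((e x).1.val + (e x).2.val) % 2 = 0 then (1 : ℤˣ) else -1) *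
              (∑ b : ZMod M, tubeDWavePair L M Λ e (e.symm (a, b)))ᴴ -
            (∑ b : ZMod M, tubeDWavePair L M Λ e (e.symm (a, b)))ᴴ *
              etaRaise (fun x => if ((e x).1.val + (e x).2.val) % 2 = 0 then (1 : ℤˣ) else -1) = 0 :=
  Summit.HubbardSuperconductivity.HubbardSuperconductivity.Theorems.WidthHaldane.stub_columnPairTriplet

/-- STUB 2 — CLOSED (landed `Theorems/WidthHaldanePairCorrAsRaisedCurrent.lean`, p159649). PAIR CORRELATOR AS RAISED CURRENT: given the triplet
identities (hypothesis = STUB 1), for every `η`-lowest-weight vector `ψ` (`η_ε ψ = 0`) and all columns `a, b`: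
`⟨Φ_a ψ, Φ_b ψ⟩ = ¼ ⟨η K_a ψ, η K_b ψ⟩` with `K_a = [η, Φ_a†]` (`Φ_a ψ = ½[η, K_a]ψ = ½ η K_a ψ`). -/
theorem stub_pairCorrAsRaisedCurrent :
    (∀ (L M : ℕ) [NeZero L] [NeZero M], Even L → Even M →
      ∀ (Λ : Type) [LinearOrder Λ] [Fintype Λ] (e : Λ ≃ ZMod L × ZMod M) (a : ZMod L),
        etaLower (fun x => if ((e x).1.val + (e x).2.val) % 2 = 0 then (1 : ℤˣ) else -1) *
              (etaLower (fun x => if ((e x).1.val + (e x).2.val) % 2 = 0 then (1 : ℤˣ) else -1) *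
                  (∑ b : ZMod M, tubeDWavePair L M Λ e (e.symm (a, b)))ᴴ -
                (∑ b : ZMod M, tubeDWavePair L M Λ e (e.symm (a, b)))ᴴ *
                  etaLower (fun x => if ((e x).1.val + (e x).2.val) % 2 = 0 then (1 : ℤˣ) else -1)) -
            (etaLower (fun x => if ((e x).1.val + (e x).2.val) % 2 = 0 then (1 : ℤˣ) else -1) *
                  (∑ b : ZMod M, tubeDWavePair L M Λ e (e.symm (a, b)))ᴴ -
                (∑ b : ZMod M, tubeDWavePair L M Λ e (e.symm (a, b)))ᴴ *
                  etaLower (fun x => if ((e x).1.val + (e x).2.val) % 2 = 0 then (1 : ℤˣ) else -1)) *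
              etaLower (fun x => if ((e x).1.val + (e x).2.val) % 2 = 0 then (1 : ℤˣ) else -1) =
          (2 : ℂ) • ∑ b : ZMod M, tubeDWavePair L M Λ e (e.symm (a, b)) ∧
        etaRaise (fun x => if ((e x).1.val + (e x).2.val) % 2 = 0 then (1 : ℤˣ) else -1) *
              (∑ b : ZMod M, tubeDWavePair L M Λ e (e.symm (a, b)))ᴴ -
            (∑ b : ZMod M, tubeDWavePair L M Λ e (e.symm (a, b)))ᴴ *
              etaRaise (fun x => if ((e x).1.val + (e x).2.val) % 2 = 0 then (1 : ℤˣ) else -1) = 0) →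
    ∀ (L M : ℕ) [NeZero L] [NeZero M], Even L → Even M →
      ∀ (Λ : Type) [LinearOrder Λ] [Fintype Λ] (e : Λ ≃ ZMod L × ZMod M) (ψ : Fock (Orb Λ)) (a b : ZMod L),
        etaLower (fun x => if ((e x).1.val + (e x).2.val) % 2 = 0 then (1 : ℤˣ) else -1) *ᵥ ψ = 0 →
          star ((∑ b' : ZMod M, tubeDWavePair L M Λ e (e.symm (a, b'))) *ᵥ ψ) ⬝ᵥ
              ((∑ b' : ZMod M, tubeDWavePair L M Λ e (e.symm (b, b'))) *ᵥ ψ) =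
            (1 / 4 : ℂ) *
              (star ((etaLower (fun x => if ((e x).1.val + (e x).2.val) % 2 = 0 then (1 : ℤˣ) else -1) *
                  (etaLower (fun x => if ((e x).1.val + (e x).2.val) % 2 = 0 then (1 : ℤˣ) else -1) *
                      (∑ b' : ZMod M, tubeDWavePair L M Λ e (e.symm (a, b')))ᴴ -
                    (∑ b' : ZMod M, tubeDWavePair L M Λ e (e.symm (a, b')))ᴴ *
                      etaLower (fun x => if ((e x).1.val + (e x).2.val) % 2 = 0 then (1 : ℤˣ) else -1))) *ᵥ ψ) ⬝ᵥ
                ((etaLower (fun x => if ((e x).1.val + (e x).2.val) % 2 = 0 then (1 : ℤˣ) else -1) *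
                  (etaLower (fun x => if ((e x).1.val + (e x).2.val) % 2 = 0 then (1 : ℤˣ) else -1) *
                      (∑ b' : ZMod M, tubeDWavePair L M Λ e (e.symm (b, b')))ᴴ -
                    (∑ b' : ZMod M, tubeDWavePair L M Λ e (e.symm (b, b')))ᴴ *
                      etaLower (fun x => if ((e x).1.val + (e x).2.val) % 2 = 0 then (1 : ℤˣ) else -1))) *ᵥ ψ)) :=
  Summit.HubbardSuperconductivity.HubbardSuperconductivity.Theorems.WidthHaldane.stub_pairCorrAsRaisedCurrent

/-- STUB 3 — CLOSED (landed `Theorems/WidthHaldaneWideThinReduction.lean`, p159722). Real arithmetic + logic over the landed `tubeColumnPairCorr_ge_of_majority`.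
THE WIDE/THIN REDUCTION: tube pair order `A·L²·M² ≤ ‖Δψ‖²` with the `k = 0` majority `(1+ε)/2·L·G_ψ(0) ≤ ‖Δψ‖²`
on the wide tubes (`c·log L ≤ M`), and the law verbatim on the thin ones (`M < c·log L`), give `HaldaneLaw` with the
amplitude `A·min(1, 2ε/(1+ε))` (`R ≥ 1` so that `r̂^{-x} ≤ 1`, `x = Ξ√(ẽ″/ρ̃)/M ≥ 0`). Here
`‖Δψ‖² = Re⟨ψ, Δ†Δψ⟩`, `Δ = Σ_a Σ_b P_{e⁻¹(a,b)}`. -/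
theorem stub_wideThinReduction :
    ∀ (U δ c ε Ξ A : ℝ) (R M₂ L₁ : ℕ), 0 < ε → 0 < A → 0 ≤ Ξ → 1 ≤ R →
      (∀ (L M : ℕ) [NeZero L] [NeZero M], Even L → Even M → M₂ ≤ M → M ≤ L → L₁ ≤ L →
        c * Real.log (L : ℝ) ≤ (M : ℝ) →
          ∀ (Λ : Type) [LinearOrder Λ] [Fintype Λ] (e : Λ ≃ ZMod L × ZMod M) (ψ : Fock (Orb Λ)),
            star ψ ⬝ᵥ ψ = 1 → IsGroundStateInSector (tubeH0 L M Λ e U) (tubeFilling L M δ) 0 ψ →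
              A * (L : ℝ) ^ 2 * (M : ℝ) ^ 2 ≤
                  (expect ((∑ a : ZMod L, ∑ b : ZMod M, tubeDWavePair L M Λ e (e.symm (a, b)))ᴴ *
                    (∑ a : ZMod L, ∑ b : ZMod M, tubeDWavePair L M Λ e (e.symm (a, b)))) ψ).re ∧
                (1 + ε) / 2 * ((L : ℝ) * tubeColumnPairCorr L M Λ e ψ 0) ≤
                  (expect ((∑ a : ZMod L, ∑ b : ZMod M, tubeDWavePair L M Λ e (e.symm (a, b)))ᴴ *
                    (∑ a : ZMod L, ∑ b : ZMod M, tubeDWavePair L M Λ e (e.symm (a, b)))) ψ).re) →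
      (∀ (L M : ℕ) [NeZero L] [NeZero M], Even L → Even M → M₂ ≤ M → M ≤ L → L₁ ≤ L →
        (M : ℝ) < c * Real.log (L : ℝ) →
          ∀ (Λ : Type) [LinearOrder Λ] [Fintype Λ] (e : Λ ≃ ZMod L × ZMod M) (ψ : Fock (Orb Λ)),
            star ψ ⬝ᵥ ψ = 1 → IsGroundStateInSector (tubeH0 L M Λ e U) (tubeFilling L M δ) 0 ψ →
              ∀ r : ZMod L, R ≤ r.val → r.val + R ≤ L →
                A * (L : ℝ) * (M : ℝ) ^ 2 * ((min r.val (L - r.val) : ℕ) : ℝ) ^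
                    (-(Ξ * Real.sqrt (tubePairCompressibility L M Λ e U δ / tubeStiffness L M Λ e U δ) / (M : ℝ))) ≤
                  tubeColumnPairCorr L M Λ e ψ r) →
      HaldaneLaw U δ Ξ (A * min 1 (2 * ε / (1 + ε))) R M₂ L₁ :=
  Summit.HubbardSuperconductivity.HubbardSuperconductivity.Theorems.WidthHaldane.stub_wideThinReduction

/-- STUB 4 (LEAD; open core A — conjecture-strength, STRONGER than the crux). THE WINDOW BRIDGE of card
`frustration-cost-duality` (its S3 `UniformThermo ⇒ LowEnergyWindowLaw`): width-uniform thermodynamics force, for some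
window `Ω(L, M, r) > 0` and Haldane constants, the floor `A·L·M²·r̂^{-Ξ√(ẽ″/ρ̃)/M} ≤ G_φ(r)` on EVERY normalised sector
vector `φ` of energy `≤ E₀ + Ω` (physically `Ω ≍ ρ̃·L·M/r̂²`, the phase-slip scale). The landed Feshbach step turns it
into the dual law and the law (`haldaneLaw_of_windowLaw`). -/
theorem stub_windowBridge :
    ∀ U : ℝ, 0 < U → ∀ δ ∈ Set.Ioo (0 : ℝ) (3 / 10), ∀ (d₀ k₀ : ℝ) (M₁ L₀ : ℕ), 0 < d₀ →
      UniformThermo U δ d₀ k₀ M₁ L₀ →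
        ∃ Ξ : ℝ, 0 < Ξ ∧ ∃ A : ℝ, 0 < A ∧ ∃ (R M₂ L₁ : ℕ) (Ω : ℕ → ℕ → ℕ → ℝ), (∀ L M n, 0 < Ω L M n) ∧
          ∀ (L M : ℕ) [NeZero L] [NeZero M], Even L → Even M → M₂ ≤ M → M ≤ L → L₁ ≤ L →
            ∀ (Λ : Type) [LinearOrder Λ] [Fintype Λ] (e : Λ ≃ ZMod L × ZMod M) (r : ZMod L),
              R ≤ r.val → r.val + R ≤ L →
                ∀ φ : Fock (Orb Λ), φ ∈ szSector (tubeFilling L M δ) 0 → star φ ⬝ᵥ φ = 1 →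
                  (expect (tubeH0 L M Λ e U) φ).re ≤
                      (tubeH0 L M Λ e U).minEnergyOn (szSector (tubeFilling L M δ) 0) + Ω L M r.val →
                    A * (L : ℝ) * (M : ℝ) ^ 2 * ((min r.val (L - r.val) : ℕ) : ℝ) ^
                        (-(Ξ * Real.sqrt (tubePairCompressibility L M Λ e U δ / tubeStiffness L M Λ e U δ) / (M : ℝ))) ≤
                      tubeColumnPairCorr L M Λ e φ r := by
  sorry

/-- STUB 5 (LEAD; open core B — conjecture-strength, at least crux-strength). THE WIDE/THIN BRIDGE of card
`bochner-majority-split`, fed the η-triplet identities (STUBS 1–2) as handles: width-uniform thermodynamics force,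
for some `c, ε, Ξ, A > 0`, `R ≥ 1`, `M₂`, `L₁`, (wide) tube pair order `A·L²M² ≤ ‖Δψ‖²` with `k = 0` majority
`(1+ε)/2·L·G_ψ(0) ≤ ‖Δψ‖²` on every admissible tube with `c·log L ≤ M`, and (thin) the law verbatim when `M < c·log L`. -/
theorem stub_wideThinBridge :
    ∀ U : ℝ, 0 < U → ∀ δ ∈ Set.Ioo (0 : ℝ) (3 / 10), ∀ (d₀ k₀ : ℝ) (M₁ L₀ : ℕ), 0 < d₀ →
      UniformThermo U δ d₀ k₀ M₁ L₀ →
      (∀ (L M : ℕ) [NeZero L] [NeZero M], Even L → Even M →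
        ∀ (Λ : Type) [LinearOrder Λ] [Fintype Λ] (e : Λ ≃ ZMod L × ZMod M) (a : ZMod L),
          etaLower (fun x => if ((e x).1.val + (e x).2.val) % 2 = 0 then (1 : ℤˣ) else -1) *
                (etaLower (fun x => if ((e x).1.val + (e x).2.val) % 2 = 0 then (1 : ℤˣ) else -1) *
                    (∑ b : ZMod M, tubeDWavePair L M Λ e (e.symm (a, b)))ᴴ -
                  (∑ b : ZMod M, tubeDWavePair L M Λ e (e.symm (a, b)))ᴴ *
                    etaLower (fun x => if ((e x).1.val + (e x).2.val) % 2 = 0 then (1 : ℤˣ) else -1)) -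
              (etaLower (fun x => if ((e x).1.val + (e x).2.val) % 2 = 0 then (1 : ℤˣ) else -1) *
                    (∑ b : ZMod M, tubeDWavePair L M Λ e (e.symm (a, b)))ᴴ -
                  (∑ b : ZMod M, tubeDWavePair L M Λ e (e.symm (a, b)))ᴴ *
                    etaLower (fun x => if ((e x).1.val + (e x).2.val) % 2 = 0 then (1 : ℤˣ) else -1)) *
                etaLower (fun x => if ((e x).1.val + (e x).2.val) % 2 = 0 then (1 : ℤˣ) else -1) =
            (2 : ℂ) • ∑ b : ZMod M, tubeDWavePair L M Λ e (e.symm (a, b)) ∧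
          etaRaise (fun x => if ((e x).1.val + (e x).2.val) % 2 = 0 then (1 : ℤˣ) else -1) *
                (∑ b : ZMod M, tubeDWavePair L M Λ e (e.symm (a, b)))ᴴ -
              (∑ b : ZMod M, tubeDWavePair L M Λ e (e.symm (a, b)))ᴴ *
                etaRaise (fun x => if ((e x).1.val + (e x).2.val) % 2 = 0 then (1 : ℤˣ) else -1) = 0) →
      (∀ (L M : ℕ) [NeZero L] [NeZero M], Even L → Even M →
        ∀ (Λ : Type) [LinearOrder Λ] [Fintype Λ] (e : Λ ≃ ZMod L × ZMod M) (ψ : Fock (Orb Λ)) (a b : ZMod L),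
          etaLower (fun x => if ((e x).1.val + (e x).2.val) % 2 = 0 then (1 : ℤˣ) else -1) *ᵥ ψ = 0 →
            star ((∑ b' : ZMod M, tubeDWavePair L M Λ e (e.symm (a, b'))) *ᵥ ψ) ⬝ᵥ
                ((∑ b' : ZMod M, tubeDWavePair L M Λ e (e.symm (b, b'))) *ᵥ ψ) =
              (1 / 4 : ℂ) *
                (star ((etaLower (fun x => if ((e x).1.val + (e x).2.val) % 2 = 0 then (1 : ℤˣ) else -1) *
                    (etaLower (fun x => if ((e x).1.val + (e x).2.val) % 2 = 0 then (1 : ℤˣ) else -1) *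
                        (∑ b' : ZMod M, tubeDWavePair L M Λ e (e.symm (a, b')))ᴴ -
                      (∑ b' : ZMod M, tubeDWavePair L M Λ e (e.symm (a, b')))ᴴ *
                        etaLower (fun x => if ((e x).1.val + (e x).2.val) % 2 = 0 then (1 : ℤˣ) else -1))) *ᵥ ψ) ⬝ᵥ
                  ((etaLower (fun x => if ((e x).1.val + (e x).2.val) % 2 = 0 then (1 : ℤˣ) else -1) *
                    (etaLower (fun x => if ((e x).1.val + (e x).2.val) % 2 = 0 then (1 : ℤˣ) else -1) *
                        (∑ b' : ZMod M, tubeDWavePair L M Λ e (e.symm (b, b')))ᴴ -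
                      (∑ b' : ZMod M, tubeDWavePair L M Λ e (e.symm (b, b')))ᴴ *
                        etaLower (fun x => if ((e x).1.val + (e x).2.val) % 2 = 0 then (1 : ℤˣ) else -1))) *ᵥ ψ))) →
        ∃ c : ℝ, 0 < c ∧ ∃ ε : ℝ, 0 < ε ∧ ∃ Ξ : ℝ, 0 < Ξ ∧ ∃ A : ℝ, 0 < A ∧ ∃ R M₂ L₁ : ℕ, 1 ≤ R ∧
          (∀ (L M : ℕ) [NeZero L] [NeZero M], Even L → Even M → M₂ ≤ M → M ≤ L → L₁ ≤ L →
            c * Real.log (L : ℝ) ≤ (M : ℝ) →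
              ∀ (Λ : Type) [LinearOrder Λ] [Fintype Λ] (e : Λ ≃ ZMod L × ZMod M) (ψ : Fock (Orb Λ)),
                star ψ ⬝ᵥ ψ = 1 → IsGroundStateInSector (tubeH0 L M Λ e U) (tubeFilling L M δ) 0 ψ →
                  A * (L : ℝ) ^ 2 * (M : ℝ) ^ 2 ≤
                      (expect ((∑ a : ZMod L, ∑ b : ZMod M, tubeDWavePair L M Λ e (e.symm (a, b)))ᴴ *
                        (∑ a : ZMod L, ∑ b : ZMod M, tubeDWavePair L M Λ e (e.symm (a, b)))) ψ).re ∧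
                    (1 + ε) / 2 * ((L : ℝ) * tubeColumnPairCorr L M Λ e ψ 0) ≤
                      (expect ((∑ a : ZMod L, ∑ b : ZMod M, tubeDWavePair L M Λ e (e.symm (a, b)))ᴴ *
                        (∑ a : ZMod L, ∑ b : ZMod M, tubeDWavePair L M Λ e (e.symm (a, b)))) ψ).re) ∧
          (∀ (L M : ℕ) [NeZero L] [NeZero M], Even L → Even M → M₂ ≤ M → M ≤ L → L₁ ≤ L →
            (M : ℝ) < c * Real.log (L : ℝ) →
              ∀ (Λ : Type) [LinearOrder Λ] [Fintype Λ] (e : Λ ≃ ZMod L × ZMod M) (ψ : Fock (Orb Λ)),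
                star ψ ⬝ᵥ ψ = 1 → IsGroundStateInSector (tubeH0 L M Λ e U) (tubeFilling L M δ) 0 ψ →
                  ∀ r : ZMod L, R ≤ r.val → r.val + R ≤ L →
                    A * (L : ℝ) * (M : ℝ) ^ 2 * ((min r.val (L - r.val) : ℕ) : ℝ) ^
                        (-(Ξ * Real.sqrt (tubePairCompressibility L M Λ e U δ / tubeStiffness L M Λ e U δ) / (M : ℝ))) ≤
                      tubeColumnPairCorr L M Λ e ψ r) := by
  sorry

/-! ## Compositions (kernel-checked, no `sorry` below this line) -/

/-- COMPOSITION A — the crux BY NAME from core A and the landed Feshbach step. [folklore] -/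
theorem WidthHaldaneBridge_of : WidthHaldaneBridge := by
  rw [widthHaldaneBridge_iff]
  intro U hU δ hδ d₀ k₀ M₁ L₀ hd₀ hUT
  obtain ⟨Ξ, hΞ, A, hA, R, M₂, L₁, Ω, hΩ, hwin⟩ := stub_windowBridge U hU δ hδ d₀ k₀ M₁ L₀ hd₀ hUT
  exact ⟨Ξ, hΞ, A, hA, R, M₂, L₁, haldaneLaw_of_windowLaw (by linarith [hδ.1]) Ω hΩ hwin⟩

/-- COMPOSITION B — the crux BY NAME from core B (fed the η-identities, STUBS 1–2) and the wide/thin reduction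
(STUB 3). [folklore] -/
theorem WidthHaldaneBridge_of_wideThin : WidthHaldaneBridge := by
  rw [widthHaldaneBridge_iff]
  intro U hU δ hδ d₀ k₀ M₁ L₀ hd₀ hUT
  obtain ⟨c, _hc, ε, hε, Ξ, hΞ, A, hA, R, M₂, L₁, hR, hW, hT⟩ :=
    stub_wideThinBridge U hU δ hδ d₀ k₀ M₁ L₀ hd₀ hUT stub_columnPairTriplet
      (stub_pairCorrAsRaisedCurrent stub_columnPairTriplet)
  refine ⟨Ξ, hΞ, A * min 1 (2 * ε / (1 + ε)), ?_, R, M₂, L₁,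
    stub_wideThinReduction U δ c ε Ξ A R M₂ L₁ hε hA hΞ.le hR hW hT⟩
  have h2 : 0 < 2 * ε / (1 + ε) := by positivity
  exact mul_pos hA (lt_min one_pos h2)

end Summit.HubbardSuperconductivity.HubbardSuperconductivity.Cruxes.WidthHaldaneBridge.Lines.IdeaSketchK2

end
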